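import Literature.Analysis.OperatorTheory.PositiveKernelNormLogConvex
import Mathlib.Analysis.CStarAlgebra.Matrix
import Mathlib.Analysis.Matrix.Order
import Mathlib.Analysis.SpecialFunctions.ContinuousFunctionalCalculus.Rpow.Basic
import HarnessLib

/-!
# Convexity of the top eigenvalue of a diagonal congruence `D_t Q D_t` of a positive
# semidefinite matrix, and the secant bracket for its Hellmann–Feynman value — PROVED

Topic `Literature/Analysis/OperatorTheory`; companion of `PositiveKernelNormLogConvex.lean` (which
proves Kingman's LOG-convexity of the norm of positive-KERNEL operators and the secant bracket for a
function touching a convex function from below). Theorems only (no definition, no named fact).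

## 1. The statement

Let `S` be a finite index set, `Q` a FIXED positive semidefinite real `S × S` matrix, and
`D_t = diagonal (d t)` a diagonal matrix whose entries depend on a parameter `t` ranging over a convex
set `D` (of any real vector space) in such a way that every `t ↦ d_c(t)²` is convex on `D`. Then the
ℓ²-operator norm

  `Λ₀(t) := ‖D_t Q D_t‖`  (Mathlib's `Matrix.Norms.L2Operator` norm = the norm of the operator on
  `EuclideanSpace ℝ S`; for the positive semidefinite matrix `D_t Q D_t` this is its LARGEST EIGENVALUE,
  by the Rayleigh–Ritz theorem [cite: HornJohnson2013, Thm. 4.2.2 (c)])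

is a CONVEX function of `t` on `D` (`convexOn_l2_opNorm_diagonal_mul_mul_diagonal`; two-point form
`l2_opNorm_diagonal_mul_mul_diagonal_le`). Proof: write `Q = R R` with `R = Q^{1/2}` symmetric
(`CFC.sqrt`); then `D Q D = (R D)ᴴ (R D)`, so `‖D Q D‖ = ‖R D‖² = ‖(R D)ᴴ‖² = ‖D R‖²` (C⋆-identity and
`‖Aᴴ‖ = ‖A‖`), and `‖D R‖² = sup_{‖x‖ ≤ 1} ‖D R x‖² = sup_x Σ_c d_c² · (R x)_c²` is a pointwise supremum
of non-negative combinations of the convex functions `d_c²`, hence convex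
[cite: HiriarturrutyLemarechal2001, §B.1.3 (e) and Prop. B.2.1.2 (PDF pp. 92, 95)] — the same
mechanism by which the largest eigenvalue `λ₁(M) = max {uᵀ M u : uᵀ u = 1}` is a convex function of a
symmetric matrix [cite: HiriarturrutyLemarechal2001, §D.5.1 (5.1.1) (PDF p. 191)]. No sign condition on
the `d_c` is needed; the corollary `convexOn_l2_opNorm_sqrt_congr` is the form `D_t = diag(√k_c(t))`
with `k_c ≥ 0` convex.

## 2. The secant bracket for the Hellmann–Feynman value (no differentiability of `Λ₀` needed)

For a unit vector `ψ` with `⟪ψ, D_β Q D_β ψ⟫ = Λ₀(β)` (a normalised top eigenvector) the function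
`g(t) = ⟪ψ, D_t Q D_t ψ⟫` touches the convex function `Λ₀` from below at `β`; if the `d_c` are
differentiable at `β` then `g′(β) = ⟪ψ, (D′ Q D + D Q D′)(β) ψ⟫` (`hasDerivAt_inner_diagonal_mul_mul_diagonal`)
and the chords of `Λ₀` bracket it:

  `(Λ₀(β) - Λ₀(β-h))/h ≤ ⟪ψ, (D′QD + DQD′)(β) ψ⟫ ≤ (Λ₀(β+h) - Λ₀(β))/h`

(`secant_bracket_diagonal_mul_mul_diagonal`, general chords `…'` with `x₁ < x₂ ≤ β ≤ x₃ < x₄`), by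
`secant_le_hasDerivAt_le_secant` of the companion file [cite: Dudley2002, §6.3 Cor. 6.3.3]. This is the
abstract form of the statement that the directional derivative of the largest eigenvalue is the maximum
of `uᵀ P u` over normalised top eigenvectors `u` [cite: HiriarturrutyLemarechal2001, §D.5.1 (5.1.3)
(PDF p. 191)]: in particular, when `Λ₀` IS differentiable at `β` its derivative equals the
Hellmann–Feynman value (`hasDerivAt_eq_of_touching`, `hasDerivAt_norm_eq_hellmannFeynman`), and when
moreover no `d_c(β)` vanishes and `D_β Q D_β ψ = Λ ψ`, the Hellmann–Feynman value has the closed form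
`2Λ Σ_c (d_c′/d_c) ψ_c²` (`inner_deriv_congr_eq_of_eigenvector`), i.e. `Λ Σ_c (k_c′/k_c) ψ_c²` for
`d_c = √k_c`.

The operator-level plain (not logarithmic) brackets `norm_secant_bracket`, `norm_secant_bracket'` for a
family `t ↦ T t` of bounded operators on a real Hilbert space with `t ↦ ‖T t‖` convex are recorded on
the way (the companion file has the `log ‖T t‖` versions).

## 3. Why this file exists (application, by dictionary only)

Truncated transfer matrices of lattice gauge theory in a character basis have the shape
`W_S(β_t) = D(β_t) · Q · D(β_t)` with `Q = P_S V̂ P_S ⪰ 0` independent of the coupling `β_t` and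
`D(β_t) = diag(√k_c(β_t))`, `k_c(β_t) = Π_links 2 I_{2j+1}(β_t)/β_t` a power series with non-negative
coefficients (hence convex); §1 says the top eigenvalue of `W_S` is convex in `β_t` for EVERY kept set
`S`, and §2 says that certified enclosures of it at `β_t - h, β_t, β_t + h` bracket the Hellmann–Feynman
value. Nothing about Bessel functions or lattice gauge theory is formalised here.

## 4. `‖A‖ = max |λ_j|` (so that "top eigenvalue" is by name)

For a real symmetric matrix, `|λ_j(A)| ≤ ‖A‖` for every eigenvalue (`abs_eigenvalues_le_l2_opNorm_real`,
test on a unit eigenvector) and `‖A‖ ≤ C` whenever all `|λ_j(A)| ≤ C` (`l2_opNorm_le_of_abs_eigenvalues_le`,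
expand in Mathlib's orthonormal `eigenvectorBasis`); hence `‖A‖ = max_j |λ_j(A)|`
(`l2_opNorm_eq_abs_eigenvalues_of_isMax`) and, for `A ⪰ 0`, `‖A‖ = λ_max(A)`
(`l2_opNorm_eq_eigenvalues_of_posSemidef`) [cite: HornJohnson2013, Thm. 4.2.2 (c)]. A unit vector `ψ`
with `A ψ = Λ ψ`, `Λ ≥ λ_j(A)` for all `j`, realises the norm: `⟪ψ, op(A) ψ⟫ = ‖A‖ = Λ`
(`inner_toEuclideanCLM_eq_l2_opNorm_of_top_eigenvector`) — this discharges the hypothesis `htop` of §2–§3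
from eigen-data (`secant_bracket_diagonal_mul_mul_diagonal_of_eigenvector`).

## Mathlib / tree search

Mathlib: `Matrix.l2_opNorm_conjTranspose_mul_self` (C⋆-identity for the ℓ²-operator norm),
`Matrix.l2_opNorm_conjTranspose`, `Matrix.toEuclideanCLM`, `Matrix.inner_toEuclideanCLM`, `CFC.sqrt`,
`EuclideanSpace.real_norm_sq_eq`, `IsLocalMin.hasDerivAt_eq_zero`; no convexity statement for the norm /
top eigenvalue of a parametrised matrix family (`lean search 'convexOn.*opNorm|eigenvalues.*[cC]onvex'`:
nothing relevant). Tree: `PositiveKernelNormLogConvex.lean` §2/§4 (`secant_le_hasDerivAt_le_secant`,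
`secant_le_of_hasDerivAt`, `hasDerivAt_le_secant`).

## References

* J.-B. Hiriart-Urruty, C. Lemaréchal, *Fundamentals of Convex Analysis*, Springer 2001, §B.1.3 (e)
  (sums of largest eigenvalues are convex, as suprema of linear functions), Prop. B.2.1.2 (pointwise
  supremum of convex functions), §D.5.1 (largest eigenvalue: (5.1.1) variational formula, (5.1.3)
  subdifferential and directional derivatives). [HiriarturrutyLemarechal2001]
* R. A. Horn, C. R. Johnson, *Matrix Analysis*, 2nd ed., CUP 2013, Thm. 4.2.2 (Rayleigh quotient
  theorem). [HornJohnson2013]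
* R. M. Dudley, *Real Analysis and Probability*, CUP 2002, §6.3 Cor. 6.3.3. [Dudley2002]
-/

noncomputable section

open Set Filter Topology Matrix
open scoped RealInnerProductSpace Matrix.Norms.L2Operator MatrixOrder

namespace Literature.Analysis.OperatorTheory

/-! ## 1. Convexity of `t ↦ ‖D_t Q D_t‖` -/

section Congruence

variable {S : Type*} [Fintype S] [DecidableEq S]

/-- **Coordinates of `D B x`**: `(diagonal d * B) x` has `c`-th coordinate `d_c · (B x)_c`.
[cite: HornJohnson2013, §0.9.1 (diagonal matrices act coordinatewise)] -/
theorem toEuclideanCLM_diagonal_mul_apply (d : S → ℝ) (B : Matrix S S ℝ)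
    (x : EuclideanSpace ℝ S) (c : S) :
    toEuclideanCLM (n := S) (𝕜 := ℝ) (diagonal d * B) x c = d c * (B *ᵥ WithLp.ofLp x) c := by
  have h : WithLp.ofLp (toEuclideanCLM (n := S) (𝕜 := ℝ) (diagonal d * B) x) c =
      ((diagonal d * B) *ᵥ WithLp.ofLp x) c := by
    rw [Matrix.ofLp_toEuclideanCLM]
  rw [← Matrix.mulVec_mulVec, Matrix.mulVec_diagonal] at h
  exact h

/-- **`‖D B x‖² = Σ_c d_c² (B x)_c²`.** [cite: HornJohnson2013, §0.6.1 (Euclidean norm)] -/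
theorem norm_toEuclideanCLM_diagonal_mul_sq (d : S → ℝ) (B : Matrix S S ℝ)
    (x : EuclideanSpace ℝ S) :
    ‖toEuclideanCLM (n := S) (𝕜 := ℝ) (diagonal d * B) x‖ ^ 2 = ∑ c, d c ^ 2 * (B *ᵥ WithLp.ofLp x) c ^ 2 := by
  rw [EuclideanSpace.real_norm_sq_eq]
  refine Finset.sum_congr rfl fun c _ => ?_
  rw [toEuclideanCLM_diagonal_mul_apply, mul_pow]

/-- **Two-point convexity estimate for `‖D B‖²`.** If `d_c² ≤ a·d₀_c² + b·d₁_c²` for all `c`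
(`a, b ≥ 0`), then `‖diagonal d * B‖² ≤ a·‖diagonal d₀ * B‖² + b·‖diagonal d₁ * B‖²`: for every `x`,
`‖D B x‖² = Σ_c d_c² (Bx)_c² ≤ a‖D₀ B x‖² + b‖D₁ B x‖² ≤ (a‖D₀B‖² + b‖D₁B‖²)‖x‖²` — a supremum of
non-negative combinations of convex functions is convex.
[cite: HiriarturrutyLemarechal2001, Prop. B.2.1.2 (PDF p. 95)] -/
theorem l2_opNorm_diagonal_mul_sq_le (B : Matrix S S ℝ) {d d₀ d₁ : S → ℝ} {a b : ℝ}
    (ha : 0 ≤ a) (hb : 0 ≤ b) (h : ∀ c, d c ^ 2 ≤ a * d₀ c ^ 2 + b * d₁ c ^ 2) :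
    ‖diagonal d * B‖ ^ 2 ≤ a * ‖diagonal d₀ * B‖ ^ 2 + b * ‖diagonal d₁ * B‖ ^ 2 := by
  set R : ℝ := a * ‖diagonal d₀ * B‖ ^ 2 + b * ‖diagonal d₁ * B‖ ^ 2 with hR
  have hR0 : 0 ≤ R := by positivity
  -- `‖D B x‖ ≤ √R ‖x‖` for every `x`
  have hle : ‖toEuclideanCLM (n := S) (𝕜 := ℝ) (diagonal d * B)‖ ≤ Real.sqrt R := by
    refine ContinuousLinearMap.opNorm_le_bound _ (Real.sqrt_nonneg R) fun x => ?_
    have hsq : ‖toEuclideanCLM (n := S) (𝕜 := ℝ) (diagonal d * B) x‖ ^ 2 ≤ (Real.sqrt R * ‖x‖) ^ 2 := by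
      rw [mul_pow, Real.sq_sqrt hR0, norm_toEuclideanCLM_diagonal_mul_sq]
      calc ∑ c, d c ^ 2 * (B *ᵥ WithLp.ofLp x) c ^ 2
          ≤ ∑ c, (a * d₀ c ^ 2 + b * d₁ c ^ 2) * (B *ᵥ WithLp.ofLp x) c ^ 2 :=
            Finset.sum_le_sum fun c _ => mul_le_mul_of_nonneg_right (h c) (sq_nonneg _)
        _ = a * ‖toEuclideanCLM (n := S) (𝕜 := ℝ) (diagonal d₀ * B) x‖ ^ 2 +
            b * ‖toEuclideanCLM (n := S) (𝕜 := ℝ) (diagonal d₁ * B) x‖ ^ 2 := by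
            rw [norm_toEuclideanCLM_diagonal_mul_sq, norm_toEuclideanCLM_diagonal_mul_sq,
              Finset.mul_sum, Finset.mul_sum, ← Finset.sum_add_distrib]
            refine Finset.sum_congr rfl fun c _ => ?_
            ring
        _ ≤ a * (‖toEuclideanCLM (n := S) (𝕜 := ℝ) (diagonal d₀ * B)‖ * ‖x‖) ^ 2 +
            b * (‖toEuclideanCLM (n := S) (𝕜 := ℝ) (diagonal d₁ * B)‖ * ‖x‖) ^ 2 := by
            gcongr
            · exact (toEuclideanCLM (n := S) (𝕜 := ℝ) (diagonal d₀ * B)).le_opNorm x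
            · exact (toEuclideanCLM (n := S) (𝕜 := ℝ) (diagonal d₁ * B)).le_opNorm x
        _ = R * ‖x‖ ^ 2 := by
            rw [hR, Matrix.l2_opNorm_toEuclideanCLM, Matrix.l2_opNorm_toEuclideanCLM]; ring
    nlinarith [norm_nonneg (toEuclideanCLM (n := S) (𝕜 := ℝ) (diagonal d * B) x), Real.sqrt_nonneg R,
      norm_nonneg x, mul_nonneg (Real.sqrt_nonneg R) (norm_nonneg x)]
  rw [Matrix.l2_opNorm_toEuclideanCLM] at hle
  calc ‖diagonal d * B‖ ^ 2 ≤ Real.sqrt R ^ 2 := by gcongr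
    _ = R := Real.sq_sqrt hR0

/-- **`‖D Q D‖ = ‖D Q^{1/2}‖²` for `Q ⪰ 0`**: with `R = Q^{1/2}` (`CFC.sqrt Q`, symmetric, `R R = Q`),
`D Q D = (R D)ᴴ (R D)`, so `‖D Q D‖ = ‖R D‖² = ‖(R D)ᴴ‖² = ‖D R‖²` (C⋆-identity for the ℓ²-operator
norm and `‖Aᴴ‖ = ‖A‖`). [cite: HornJohnson2013, Thm. 7.2.6 (positive semidefinite square root) and
§5.6 (spectral norm)] -/
theorem l2_opNorm_diagonal_mul_mul_diagonal_eq {Q : Matrix S S ℝ} (hQ : Q.PosSemidef) (d : S → ℝ) :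
    ‖diagonal d * Q * diagonal d‖ = ‖diagonal d * CFC.sqrt Q‖ ^ 2 := by
  have hQ0 : 0 ≤ Q := Matrix.nonneg_iff_posSemidef.mpr hQ
  set R : Matrix S S ℝ := CFC.sqrt Q with hRdef
  have hRR : R * R = Q := CFC.sqrt_mul_sqrt_self Q hQ0
  have hRh : Rᴴ = R := by
    have h : star R = R := (CFC.sqrt_nonneg Q).isSelfAdjoint.star_eq
    rwa [Matrix.star_eq_conjTranspose] at h
  have hDh : (diagonal d)ᴴ = diagonal d := by
    rw [Matrix.diagonal_conjTranspose]
    rfl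
  -- `D Q D = (R D)ᴴ (R D)`
  have hfac : diagonal d * Q * diagonal d = (R * diagonal d)ᴴ * (R * diagonal d) := by
    rw [Matrix.conjTranspose_mul, hRh, hDh, ← hRR]
    simp only [Matrix.mul_assoc]
  -- `‖(R D)ᴴ‖ = ‖D R‖`
  have hadj : (R * diagonal d)ᴴ = diagonal d * R := by
    rw [Matrix.conjTranspose_mul, hRh, hDh]
  rw [hfac, Matrix.l2_opNorm_conjTranspose_mul_self, ← Matrix.l2_opNorm_conjTranspose, hadj, sq]

/-- **Two-point convexity of the top eigenvalue of a diagonal congruence.** Let `Q ⪰ 0` be a fixed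
real symmetric positive semidefinite matrix and `d, d₀, d₁ : S → ℝ` with `d_c² ≤ a·d₀_c² + b·d₁_c²`
for all `c` (`a, b ≥ 0`; e.g. `d = d(θt₀+(1-θ)t₁)`, `a = θ`, `b = 1-θ` for convex `t ↦ d_c(t)²`). Then
`‖D Q D‖ ≤ a‖D₀ Q D₀‖ + b‖D₁ Q D₁‖` for the ℓ²-operator norm (= largest eigenvalue of these positive
semidefinite matrices [cite: HornJohnson2013, Thm. 4.2.2 (c)]).
[cite: HiriarturrutyLemarechal2001, §B.1.3 (e), Prop. B.2.1.2 (PDF pp. 92, 95)] -/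
theorem l2_opNorm_diagonal_mul_mul_diagonal_le {Q : Matrix S S ℝ} (hQ : Q.PosSemidef)
    {d d₀ d₁ : S → ℝ} {a b : ℝ} (ha : 0 ≤ a) (hb : 0 ≤ b)
    (h : ∀ c, d c ^ 2 ≤ a * d₀ c ^ 2 + b * d₁ c ^ 2) :
    ‖diagonal d * Q * diagonal d‖ ≤
      a * ‖diagonal d₀ * Q * diagonal d₀‖ + b * ‖diagonal d₁ * Q * diagonal d₁‖ := by
  rw [l2_opNorm_diagonal_mul_mul_diagonal_eq hQ, l2_opNorm_diagonal_mul_mul_diagonal_eq hQ,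
    l2_opNorm_diagonal_mul_mul_diagonal_eq hQ]
  exact l2_opNorm_diagonal_mul_sq_le (CFC.sqrt Q) ha hb h

variable {E : Type*} [AddCommGroup E] [Module ℝ E] {D : Set E}

/-- **Convexity of the top eigenvalue of `D_t Q D_t`.** Let `Q ⪰ 0` be a fixed real positive
semidefinite matrix and `t ↦ d t : S → ℝ` a family of diagonals over a convex set `D` such that every
`t ↦ d_c(t)²` is convex on `D`. Then `t ↦ ‖diagonal (d t) * Q * diagonal (d t)‖` (ℓ²-operator norm =
largest eigenvalue) is convex on `D`. [cite: HiriarturrutyLemarechal2001, §B.1.3 (e), Prop. B.2.1.2,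
§D.5.1 (5.1.1) (PDF pp. 92, 95, 191)] -/
theorem convexOn_l2_opNorm_diagonal_mul_mul_diagonal {Q : Matrix S S ℝ} (hQ : Q.PosSemidef)
    (hD : Convex ℝ D) {d : E → S → ℝ} (hd : ∀ c, ConvexOn ℝ D (fun t => d t c ^ 2)) :
    ConvexOn ℝ D (fun t => ‖diagonal (d t) * Q * diagonal (d t)‖) := by
  refine ⟨hD, fun x hx y hy a b ha hb hab => ?_⟩
  simp only [smul_eq_mul]
  exact l2_opNorm_diagonal_mul_mul_diagonal_le hQ ha hb fun c => by
    have := (hd c).2 hx hy ha hb hab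
    simpa only [smul_eq_mul] using this

/-- **The form `D_t = diag(√k_c(t))`**: for `Q ⪰ 0` and non-negative convex `t ↦ k_c(t)` on a convex
set `D`, `t ↦ ‖diag(√k(t)) Q diag(√k(t))‖` is convex on `D`.
[cite: HiriarturrutyLemarechal2001, §B.1.3 (e), Prop. B.2.1.2 (PDF pp. 92, 95)] -/
theorem convexOn_l2_opNorm_sqrt_congr {Q : Matrix S S ℝ} (hQ : Q.PosSemidef) (hD : Convex ℝ D)
    {k : E → S → ℝ} (hk : ∀ c, ConvexOn ℝ D (fun t => k t c))
    (hk0 : ∀ t ∈ D, ∀ c, 0 ≤ k t c) :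
    ConvexOn ℝ D (fun t =>
      ‖diagonal (fun c => Real.sqrt (k t c)) * Q * diagonal (fun c => Real.sqrt (k t c))‖) := by
  refine convexOn_l2_opNorm_diagonal_mul_mul_diagonal hQ hD fun c => ?_
  exact (hk c).congr fun t ht => (Real.sq_sqrt (hk0 t ht c)).symm

end Congruence

/-! ## 2. Plain secant brackets and the touching-derivative lemma -/

section Touching

/-- **Touching functions have the same derivative.** If `g ≤ f` near `β`, `g β = f β`, and both are
differentiable at `β`, then `f′(β) = g′(β)` (`f - g ≥ 0` has a local minimum at `β`). In particular,
when the top eigenvalue IS differentiable, its derivative is the Hellmann–Feynman value of any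
normalised top eigenvector. [cite: HiriarturrutyLemarechal2001, §D.5.1 (5.1.3) and the sentence after it
(`∇λ₁(M) = uuᵀ` iff `λ₁` simple) (PDF p. 191)] -/
theorem hasDerivAt_eq_of_touching {f g : ℝ → ℝ} {β f' g' : ℝ} (hle : ∀ᶠ t in 𝓝 β, g t ≤ f t)
    (heq : g β = f β) (hf : HasDerivAt f f' β) (hg : HasDerivAt g g' β) : f' = g' := by
  have hmin : IsLocalMin (fun t => f t - g t) β := by
    filter_upwards [hle] with t ht
    rw [heq, sub_self]
    linarith
  have h0 : f' - g' = 0 := hmin.hasDerivAt_eq_zero (hf.sub hg)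
  linarith

variable {H : Type*} [NormedAddCommGroup H] [InnerProductSpace ℝ H]

/-- `⟪ψ, T ψ⟫ ≤ ‖T‖` for a unit vector `ψ` (Cauchy–Schwarz). [cite: HornJohnson2013, Thm. 5.6.2 (b)
(operator norm bound) with (0.6.3) (Cauchy–Schwarz)] -/
theorem real_inner_apply_le_opNorm (T : H →L[ℝ] H) {ψ : H} (hψ : ‖ψ‖ = 1) : ⟪ψ, T ψ⟫ ≤ ‖T‖ := by
  calc ⟪ψ, T ψ⟫ ≤ ‖ψ‖ * ‖T ψ‖ := real_inner_le_norm _ _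
    _ ≤ ‖ψ‖ * (‖T‖ * ‖ψ‖) := by gcongr; exact T.le_opNorm ψ
    _ = ‖T‖ := by rw [hψ, one_mul, mul_one]

/-- **The plain secant bracket for a Hellmann–Feynman value.** Let `t ↦ T t` be bounded operators on a
real Hilbert space with `t ↦ ‖T t‖` CONVEX on `[β-h, β+h]` (`h > 0`), `ψ` a unit vector with
`⟪ψ, T β ψ⟫ = ‖T β‖` (a normalised top eigenvector of a positive operator), and
`HasDerivAt (t ↦ ⟪ψ, T t ψ⟫) g' β`. Then `(‖T β‖ - ‖T (β-h)‖)/h ≤ g' ≤ (‖T (β+h)‖ - ‖T β‖)/h` — no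
differentiability of `t ↦ ‖T t‖` and no simplicity of the top of the spectrum assumed.
[cite: Dudley2002, §6.3 Cor. 6.3.3] [cite: HiriarturrutyLemarechal2001, §D.5.1 (5.1.3) (PDF p. 191)] -/
theorem norm_secant_bracket (T : ℝ → H →L[ℝ] H) {β h : ℝ} (hh : 0 < h)
    (hconv : ConvexOn ℝ (Icc (β - h) (β + h)) (fun t => ‖T t‖))
    {ψ : H} (hψ : ‖ψ‖ = 1) (htop : ⟪ψ, T β ψ⟫ = ‖T β‖)
    {g' : ℝ} (hg : HasDerivAt (fun t => ⟪ψ, T t ψ⟫) g' β) :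
    (‖T β‖ - ‖T (β - h)‖) / h ≤ g' ∧ g' ≤ (‖T (β + h)‖ - ‖T β‖) / h :=
  secant_le_hasDerivAt_le_secant hh hconv
    (Eventually.of_forall fun t => real_inner_apply_le_opNorm (T t) hψ) htop hg

/-- **The plain secant bracket, general chords** (`x₁ < x₂ ≤ β ≤ x₃ < x₄`, the shape used by secant
certificates): with `t ↦ ‖T t‖` convex on `[x₁, x₄]`, `ψ` a unit vector with `⟪ψ, T β ψ⟫ = ‖T β‖` and
`HasDerivAt (t ↦ ⟪ψ, T t ψ⟫) g' β`,
`(‖T x₂‖ - ‖T x₁‖)/(x₂ - x₁) ≤ g' ≤ (‖T x₄‖ - ‖T x₃‖)/(x₄ - x₃)`.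
[cite: Dudley2002, §6.3 Prop. 6.3.2, Cor. 6.3.3] -/
theorem norm_secant_bracket' (T : ℝ → H →L[ℝ] H) {β x₁ x₂ x₃ x₄ : ℝ} (h12 : x₁ < x₂)
    (h2 : x₂ ≤ β) (h3 : β ≤ x₃) (h34 : x₃ < x₄)
    (hconv : ConvexOn ℝ (Icc x₁ x₄) (fun t => ‖T t‖))
    {ψ : H} (hψ : ‖ψ‖ = 1) (htop : ⟪ψ, T β ψ⟫ = ‖T β‖)
    {g' : ℝ} (hg : HasDerivAt (fun t => ⟪ψ, T t ψ⟫) g' β) :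
    (‖T x₂‖ - ‖T x₁‖) / (x₂ - x₁) ≤ g' ∧ g' ≤ (‖T x₄‖ - ‖T x₃‖) / (x₄ - x₃) := by
  have hle : ∀ᶠ t in 𝓝 β, ⟪ψ, T t ψ⟫ ≤ ‖T t‖ :=
    Eventually.of_forall fun t => real_inner_apply_le_opNorm (T t) hψ
  exact ⟨secant_le_of_hasDerivAt h12 h2 (hconv.subset (Icc_subset_Icc le_rfl (by linarith))
      (convex_Icc _ _)) hle htop hg,
    hasDerivAt_le_secant h3 h34 (hconv.subset (Icc_subset_Icc (by linarith) le_rfl) (convex_Icc _ _))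
      hle htop hg⟩

/-- **When the norm is differentiable, its derivative is the Hellmann–Feynman value**: if `ψ` is a
unit vector with `⟪ψ, T β ψ⟫ = ‖T β‖`, `t ↦ ‖T t‖` has derivative `Λ'` at `β` and `t ↦ ⟪ψ, T t ψ⟫` has
derivative `g'` at `β`, then `Λ' = g'`. [cite: HiriarturrutyLemarechal2001, §D.5.1 (5.1.3) and Remark
after it (PDF p. 191)] -/
theorem hasDerivAt_norm_eq_hellmannFeynman (T : ℝ → H →L[ℝ] H) {β Λ' g' : ℝ} {ψ : H}
    (hψ : ‖ψ‖ = 1) (htop : ⟪ψ, T β ψ⟫ = ‖T β‖) (hΛ : HasDerivAt (fun t => ‖T t‖) Λ' β)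
    (hg : HasDerivAt (fun t => ⟪ψ, T t ψ⟫) g' β) : Λ' = g' :=
  hasDerivAt_eq_of_touching (Eventually.of_forall fun t => real_inner_apply_le_opNorm (T t) hψ)
    htop hΛ hg

end Touching

/-! ## 3. The matrix family `t ↦ D_t Q D_t`: Hellmann–Feynman value and the bracket -/

section MatrixFamily

variable {S : Type*} [Fintype S] [DecidableEq S]

/-- **The quadratic form of the operator of a matrix**: `⟪ψ, op(M) ψ⟫ = Σ_i Σ_j ψ_i M_ij ψ_j`.
[cite: HornJohnson2013, §4.0 (quadratic and Hermitian forms, (4.0.1))] -/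
theorem inner_toEuclideanCLM_eq_sum (M : Matrix S S ℝ) (ψ : EuclideanSpace ℝ S) :
    ⟪ψ, toEuclideanCLM (n := S) (𝕜 := ℝ) M ψ⟫ = ∑ i, ∑ j, ψ i * M i j * ψ j := by
  rw [Matrix.inner_toEuclideanCLM]
  simp only [dotProduct, Matrix.mulVec, Finset.mul_sum, mul_assoc]

/-- Entries of a diagonal congruence: `(diagonal e * Q * diagonal f) i j = e_i Q_ij f_j`.
[cite: HornJohnson2013, §0.9.1] -/
theorem diagonal_mul_mul_diagonal_apply (e f : S → ℝ) (Q : Matrix S S ℝ) (i j : S) :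
    (diagonal e * Q * diagonal f) i j = e i * Q i j * f j := by
  rw [Matrix.mul_diagonal, Matrix.diagonal_mul]

/-- **Hellmann–Feynman value of a diagonal congruence.** If every `t ↦ d_c(t)` has derivative
`d'_c` at `β`, then for every `ψ` the form `t ↦ ⟪ψ, D_t Q D_t ψ⟫` has derivative
`⟪ψ, (D′ Q D_β + D_β Q D′) ψ⟫` at `β` (`D′ = diagonal d'`; product rule entrywise — `ψ` is FROZEN).
[cite: HiriarturrutyLemarechal2001, §D.5.1 (differentiate `uᵀ M u` in `M` with `u` fixed, (5.1.2))
(PDF p. 191)] -/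
theorem hasDerivAt_inner_diagonal_mul_mul_diagonal (Q : Matrix S S ℝ) {d : ℝ → S → ℝ}
    {d' : S → ℝ} {β : ℝ} (hd : ∀ c, HasDerivAt (fun t => d t c) (d' c) β)
    (ψ : EuclideanSpace ℝ S) :
    HasDerivAt (fun t => ⟪ψ, toEuclideanCLM (n := S) (𝕜 := ℝ) (diagonal (d t) * Q * diagonal (d t)) ψ⟫)
      ⟪ψ, toEuclideanCLM (n := S) (𝕜 := ℝ)
        (diagonal d' * Q * diagonal (d β) + diagonal (d β) * Q * diagonal d') ψ⟫ β := by
  have hfun : (fun t => ⟪ψ, toEuclideanCLM (n := S) (𝕜 := ℝ) (diagonal (d t) * Q * diagonal (d t)) ψ⟫) =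
      fun t => ∑ i, ∑ j, ψ i * (d t i * Q i j * d t j) * ψ j := by
    funext t
    rw [inner_toEuclideanCLM_eq_sum]
    simp only [diagonal_mul_mul_diagonal_apply]
  have hval : ⟪ψ, toEuclideanCLM (n := S) (𝕜 := ℝ)
      (diagonal d' * Q * diagonal (d β) + diagonal (d β) * Q * diagonal d') ψ⟫ =
      ∑ i, ∑ j, ψ i * (d' i * Q i j * d β j + d β i * Q i j * d' j) * ψ j := by
    rw [inner_toEuclideanCLM_eq_sum]
    simp only [Matrix.add_apply, diagonal_mul_mul_diagonal_apply]
  rw [hfun, hval]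
  refine HasDerivAt.fun_sum fun i _ => HasDerivAt.fun_sum fun j _ => ?_
  have h1 : HasDerivAt (fun t => d t i * Q i j * d t j)
      (d' i * Q i j * d β j + d β i * Q i j * d' j) β :=
    ((hd i).mul_const (Q i j)).fun_mul (hd j)
  have h2 := (h1.const_mul (ψ i)).mul_const (ψ j)
  simpa only [mul_assoc] using h2

/-- **Closed form of the Hellmann–Feynman value at an eigenvector.** If `D_β Q D_β ψ = Λ ψ`
(`Q` symmetric) and no `d_c(β)` vanishes, then
`⟪ψ, (D′ Q D_β + D_β Q D′) ψ⟫ = 2Λ · Σ_c (d'_c / d_c(β)) ψ_c²` — for `d_c = √k_c` this is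
`Λ Σ_c (k_c′/k_c) ψ_c²`, the `ψ²`-average of the logarithmic derivatives of the diagonal weights.
(`⟪ψ, D′ Q D ψ⟫ = ⟨D′ψ, Q D ψ⟩` and `Q D ψ = D⁻¹ (D Q D ψ) = Λ D⁻¹ ψ`; the other term is equal by
symmetry.) [cite: HiriarturrutyLemarechal2001, §D.5.1 (5.1.2)–(5.1.3) (PDF p. 191)] -/
theorem inner_deriv_congr_eq_of_eigenvector {Q : Matrix S S ℝ} (hQ : Q.IsSymm) {dβ d' : S → ℝ}
    (hne : ∀ c, dβ c ≠ 0) {ψ : EuclideanSpace ℝ S} {Λ : ℝ}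
    (heig : (diagonal dβ * Q * diagonal dβ) *ᵥ WithLp.ofLp ψ = Λ • WithLp.ofLp ψ) :
    ⟪ψ, toEuclideanCLM (n := S) (𝕜 := ℝ) (diagonal d' * Q * diagonal dβ + diagonal dβ * Q * diagonal d') ψ⟫ =
      2 * Λ * ∑ c, d' c / dβ c * ψ c ^ 2 := by
  -- the eigen-equation coordinatewise: `Σ_j Q_cj d_j ψ_j = Λ ψ_c / d_c`
  have hrow : ∀ c, ∑ j, Q c j * dβ j * ψ j = Λ * ψ c / dβ c := by
    intro c
    have hc := congrFun heig c
    simp only [Matrix.mulVec, dotProduct, diagonal_mul_mul_diagonal_apply, Pi.smul_apply,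
      smul_eq_mul] at hc
    -- `hc : ∑ j, dβ c * Q c j * dβ j * ψ j = Λ * ψ c`
    rw [eq_div_iff (hne c), ← hc, Finset.sum_mul]
    exact Finset.sum_congr rfl fun j _ => by ring
  have hsym : ∀ i j, Q i j = Q j i := fun i j => by
    have := congrFun (congrFun hQ j) i
    simpa [Matrix.transpose_apply] using this
  rw [inner_toEuclideanCLM_eq_sum]
  simp only [Matrix.add_apply, diagonal_mul_mul_diagonal_apply]
  -- split the two terms
  have hdist : ∀ i j, ψ i * (d' i * Q i j * dβ j + dβ i * Q i j * d' j) * ψ j =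
      ψ i * (d' i * Q i j * dβ j) * ψ j + ψ i * (dβ i * Q i j * d' j) * ψ j := fun i j => by ring
  simp_rw [hdist, Finset.sum_add_distrib]
  -- first term: `Σ_i d'_i ψ_i (Λ ψ_i / d_i)`
  have hA : ∀ i, ∑ j, ψ i * (d' i * Q i j * dβ j) * ψ j = d' i * ψ i * (Λ * ψ i / dβ i) := by
    intro i
    rw [← hrow i, Finset.mul_sum]
    exact Finset.sum_congr rfl fun j _ => by ring
  -- second term: swap the sums and use the symmetry of `Q`
  have hB : ∑ i, ∑ j, ψ i * (dβ i * Q i j * d' j) * ψ j = ∑ j, d' j * ψ j * (Λ * ψ j / dβ j) := by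
    rw [Finset.sum_comm]
    refine Finset.sum_congr rfl fun j _ => ?_
    rw [← hrow j, Finset.mul_sum]
    refine Finset.sum_congr rfl fun i _ => ?_
    rw [hsym j i]
    ring
  rw [Finset.sum_congr rfl fun i _ => hA i, hB, ← Finset.sum_add_distrib, Finset.mul_sum]
  refine Finset.sum_congr rfl fun c _ => ?_
  field_simp
  ring

/-- **Secant bracket for the Hellmann–Feynman value of a diagonal congruence** (three-point form).
Let `Q ⪰ 0` be fixed, `t ↦ d t` diagonals with every `t ↦ d_c(t)²` convex on `[β-h, β+h]` (`h > 0`)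
and every `t ↦ d_c(t)` differentiable at `β` with derivative `d'_c`; let `ψ` be a unit vector with
`⟪ψ, D_β Q D_β ψ⟫ = ‖D_β Q D_β‖` (a normalised top eigenvector; the ℓ²-operator norm of the positive
semidefinite matrix `D_β Q D_β` is its largest eigenvalue [cite: HornJohnson2013, Thm. 4.2.2 (c)]). Then
with `Λ₀(t) = ‖D_t Q D_t‖` and the Hellmann–Feynman value `HF = ⟪ψ, (D′ Q D_β + D_β Q D′) ψ⟫`:
`(Λ₀(β) - Λ₀(β-h))/h ≤ HF ≤ (Λ₀(β+h) - Λ₀(β))/h`. No differentiability of `Λ₀`, no simplicity of the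
top eigenvalue is assumed. [cite: HiriarturrutyLemarechal2001, §D.5.1 (5.1.1)–(5.1.3) (PDF p. 191)]
[cite: Dudley2002, §6.3 Cor. 6.3.3] -/
theorem secant_bracket_diagonal_mul_mul_diagonal {Q : Matrix S S ℝ} (hQ : Q.PosSemidef)
    {d : ℝ → S → ℝ} {d' : S → ℝ} {β h : ℝ} (hh : 0 < h)
    (hconv : ∀ c, ConvexOn ℝ (Icc (β - h) (β + h)) (fun t => d t c ^ 2))
    (hd : ∀ c, HasDerivAt (fun t => d t c) (d' c) β)
    {ψ : EuclideanSpace ℝ S} (hψ : ‖ψ‖ = 1)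
    (htop : ⟪ψ, toEuclideanCLM (n := S) (𝕜 := ℝ) (diagonal (d β) * Q * diagonal (d β)) ψ⟫ =
      ‖diagonal (d β) * Q * diagonal (d β)‖) :
    (‖diagonal (d β) * Q * diagonal (d β)‖ - ‖diagonal (d (β - h)) * Q * diagonal (d (β - h))‖) / h ≤
        ⟪ψ, toEuclideanCLM (n := S) (𝕜 := ℝ)
          (diagonal d' * Q * diagonal (d β) + diagonal (d β) * Q * diagonal d') ψ⟫ ∧
      ⟪ψ, toEuclideanCLM (n := S) (𝕜 := ℝ)
          (diagonal d' * Q * diagonal (d β) + diagonal (d β) * Q * diagonal d') ψ⟫ ≤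
        (‖diagonal (d (β + h)) * Q * diagonal (d (β + h))‖ - ‖diagonal (d β) * Q * diagonal (d β)‖) / h := by
  have hT := norm_secant_bracket
    (fun t => toEuclideanCLM (n := S) (𝕜 := ℝ) (diagonal (d t) * Q * diagonal (d t))) hh
    (by
      simp only [Matrix.l2_opNorm_toEuclideanCLM]
      exact convexOn_l2_opNorm_diagonal_mul_mul_diagonal hQ (convex_Icc _ _) hconv)
    hψ (by rw [Matrix.l2_opNorm_toEuclideanCLM]; exact htop)
    (hasDerivAt_inner_diagonal_mul_mul_diagonal Q hd ψ)
  simpa only [Matrix.l2_opNorm_toEuclideanCLM] using hT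

/-- **Secant bracket for a diagonal congruence, general chords** `x₁ < x₂ ≤ β ≤ x₃ < x₄` (the shape
of secant certificates built from enclosures of the top eigenvalue at sample couplings): with every
`t ↦ d_c(t)²` convex on `[x₁, x₄]`, `(Λ₀(x₂) - Λ₀(x₁))/(x₂ - x₁) ≤ HF ≤ (Λ₀(x₄) - Λ₀(x₃))/(x₄ - x₃)`.
[cite: HiriarturrutyLemarechal2001, §D.5.1 (5.1.1)–(5.1.3) (PDF p. 191)]
[cite: Dudley2002, §6.3 Prop. 6.3.2, Cor. 6.3.3] -/
theorem secant_bracket_diagonal_mul_mul_diagonal' {Q : Matrix S S ℝ} (hQ : Q.PosSemidef)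
    {d : ℝ → S → ℝ} {d' : S → ℝ} {β x₁ x₂ x₃ x₄ : ℝ} (h12 : x₁ < x₂) (h2 : x₂ ≤ β) (h3 : β ≤ x₃)
    (h34 : x₃ < x₄) (hconv : ∀ c, ConvexOn ℝ (Icc x₁ x₄) (fun t => d t c ^ 2))
    (hd : ∀ c, HasDerivAt (fun t => d t c) (d' c) β)
    {ψ : EuclideanSpace ℝ S} (hψ : ‖ψ‖ = 1)
    (htop : ⟪ψ, toEuclideanCLM (n := S) (𝕜 := ℝ) (diagonal (d β) * Q * diagonal (d β)) ψ⟫ =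
      ‖diagonal (d β) * Q * diagonal (d β)‖) :
    (‖diagonal (d x₂) * Q * diagonal (d x₂)‖ - ‖diagonal (d x₁) * Q * diagonal (d x₁)‖) / (x₂ - x₁) ≤
        ⟪ψ, toEuclideanCLM (n := S) (𝕜 := ℝ)
          (diagonal d' * Q * diagonal (d β) + diagonal (d β) * Q * diagonal d') ψ⟫ ∧
      ⟪ψ, toEuclideanCLM (n := S) (𝕜 := ℝ)
          (diagonal d' * Q * diagonal (d β) + diagonal (d β) * Q * diagonal d') ψ⟫ ≤
        (‖diagonal (d x₄) * Q * diagonal (d x₄)‖ - ‖diagonal (d x₃) * Q * diagonal (d x₃)‖) /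
          (x₄ - x₃) := by
  have hT := norm_secant_bracket'
    (fun t => toEuclideanCLM (n := S) (𝕜 := ℝ) (diagonal (d t) * Q * diagonal (d t))) h12 h2 h3 h34
    (by
      simp only [Matrix.l2_opNorm_toEuclideanCLM]
      exact convexOn_l2_opNorm_diagonal_mul_mul_diagonal hQ (convex_Icc _ _) hconv)
    hψ (by rw [Matrix.l2_opNorm_toEuclideanCLM]; exact htop)
    (hasDerivAt_inner_diagonal_mul_mul_diagonal Q hd ψ)
  simpa only [Matrix.l2_opNorm_toEuclideanCLM] using hT

end MatrixFamily

/-! ## 4. The ℓ²-operator norm of a real symmetric matrix is its largest |eigenvalue| -/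

section TopEigenvalue

variable {S : Type*} [Fintype S] [DecidableEq S]

/-- The operator of a real symmetric matrix acts on the eigenvector basis by the eigenvalues:
`op(A) b_j = λ_j b_j`. [cite: HornJohnson2013, Thm. 2.5.6 / Thm. 4.1.5 (spectral theorem)] -/
theorem toEuclideanCLM_apply_eigenvectorBasis {A : Matrix S S ℝ} (hA : A.IsHermitian) (j : S) :
    toEuclideanCLM (n := S) (𝕜 := ℝ) A (hA.eigenvectorBasis j) =
      hA.eigenvalues j • hA.eigenvectorBasis j := by
  refine PiLp.ext fun i => ?_
  have h := congrFun (hA.mulVec_eigenvectorBasis j) i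
  rw [PiLp.smul_apply, smul_eq_mul]
  rw [Pi.smul_apply, smul_eq_mul] at h
  rw [← h]
  exact congrFun (Matrix.ofLp_toEuclideanCLM A _) i

/-- **Every eigenvalue is bounded by the operator norm**: `|λ_j(A)| ≤ ‖A‖` for a real symmetric
matrix (test the norm on a unit eigenvector). [cite: HornJohnson2013, Thm. 5.6.9 (spectral radius ≤
any matrix norm)] -/
theorem abs_eigenvalues_le_l2_opNorm_real {A : Matrix S S ℝ} (hA : A.IsHermitian) (j : S) :
    |hA.eigenvalues j| ≤ ‖A‖ := by
  have hv : ‖(hA.eigenvectorBasis j : EuclideanSpace ℝ S)‖ = 1 := hA.eigenvectorBasis.orthonormal.1 j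
  have h := (toEuclideanCLM (n := S) (𝕜 := ℝ) A).le_opNorm (hA.eigenvectorBasis j)
  rw [toEuclideanCLM_apply_eigenvectorBasis, norm_smul, Real.norm_eq_abs, hv, mul_one, mul_one,
    Matrix.l2_opNorm_toEuclideanCLM] at h
  exact h

/-- **The operator norm is bounded by the largest |eigenvalue|**: if `|λ_j(A)| ≤ C` for all `j`
(`C ≥ 0`) then `‖A‖ ≤ C` (expand in the orthonormal eigenbasis: `‖A x‖² = Σ λ_j² |⟪b_j, x⟫|² ≤
C² ‖x‖²`). [cite: HornJohnson2013, §5.6, spectral norm of a normal matrix = spectral radius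
(5.6.P22 / Thm. 4.1.5)] -/
theorem l2_opNorm_le_of_abs_eigenvalues_le {A : Matrix S S ℝ} (hA : A.IsHermitian) {C : ℝ}
    (hC : 0 ≤ C) (h : ∀ j, |hA.eigenvalues j| ≤ C) : ‖A‖ ≤ C := by
  rw [← Matrix.l2_opNorm_toEuclideanCLM]
  refine ContinuousLinearMap.opNorm_le_bound _ hC fun x => ?_
  set b := hA.eigenvectorBasis with hb
  set T := toEuclideanCLM (n := S) (𝕜 := ℝ) A with hT
  -- `T x = Σ_j (λ_j c_j) b_j` with `c = b.repr x`
  have hTx : T x = ∑ j, (hA.eigenvalues j * b.repr x j) • b j := by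
    conv_lhs => rw [← b.sum_repr x]
    rw [map_sum]
    refine Finset.sum_congr rfl fun j _ => ?_
    rw [map_smul, hT, toEuclideanCLM_apply_eigenvectorBasis, smul_smul, mul_comm]
  set w : EuclideanSpace ℝ S := WithLp.toLp 2 (fun j => hA.eigenvalues j * b.repr x j) with hw
  have hwj : ∀ j, w j = hA.eigenvalues j * b.repr x j := fun j => rfl
  have hTx' : T x = b.repr.symm w := by
    rw [hTx, ← b.sum_repr_symm]
  have hnorm : ‖T x‖ = ‖w‖ := by rw [hTx', LinearIsometryEquiv.norm_map]
  have hsq : ‖w‖ ^ 2 ≤ (C * ‖x‖) ^ 2 := by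
    rw [EuclideanSpace.real_norm_sq_eq, mul_pow, ← b.repr.norm_map x, EuclideanSpace.real_norm_sq_eq,
      Finset.mul_sum]
    refine Finset.sum_le_sum fun j _ => ?_
    rw [hwj, mul_pow]
    have hj : hA.eigenvalues j ^ 2 ≤ C ^ 2 := by
      have := pow_le_pow_left₀ (abs_nonneg _) (h j) 2
      rwa [sq_abs] at this
    exact mul_le_mul_of_nonneg_right hj (sq_nonneg _)
  rw [hnorm]
  exact (pow_le_pow_iff_left₀ (norm_nonneg _) (by positivity) two_ne_zero).mp hsq

/-- **`‖A‖ = max_j |λ_j(A)|`** for a real symmetric matrix: if `j₀` indexes an eigenvalue of largest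
modulus then `‖A‖ = |λ_{j₀}|`. [cite: HornJohnson2013, §5.6 (spectral norm) with Thm. 4.1.5] -/
theorem l2_opNorm_eq_abs_eigenvalues_of_isMax {A : Matrix S S ℝ} (hA : A.IsHermitian) {j₀ : S}
    (hmax : ∀ j, |hA.eigenvalues j| ≤ |hA.eigenvalues j₀|) : ‖A‖ = |hA.eigenvalues j₀| :=
  le_antisymm (l2_opNorm_le_of_abs_eigenvalues_le hA (abs_nonneg _) hmax)
    (abs_eigenvalues_le_l2_opNorm_real hA j₀)

/-- **`‖A‖ = λ_max(A)` for a positive semidefinite real matrix** (Rayleigh–Ritz): if `j₀` indexes a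
largest eigenvalue then `‖A‖ = λ_{j₀}`. [cite: HornJohnson2013, Thm. 4.2.2 (c) and Thm. 7.2.6] -/
theorem l2_opNorm_eq_eigenvalues_of_posSemidef {A : Matrix S S ℝ} (hA : A.PosSemidef) {j₀ : S}
    (hmax : ∀ j, hA.1.eigenvalues j ≤ hA.1.eigenvalues j₀) : ‖A‖ = hA.1.eigenvalues j₀ := by
  have h0 : ∀ j, 0 ≤ hA.1.eigenvalues j := fun j => hA.eigenvalues_nonneg j
  have h := l2_opNorm_eq_abs_eigenvalues_of_isMax hA.1 (j₀ := j₀) fun j => by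
    rw [abs_of_nonneg (h0 j), abs_of_nonneg (h0 j₀)]; exact hmax j
  rwa [abs_of_nonneg (h0 j₀)] at h

/-- **A normalised top eigenvector realises the norm**: for `A ⪰ 0`, a unit vector `ψ` with
`A ψ = Λ ψ` and `Λ ≥ λ_j(A)` for all `j` satisfies `⟪ψ, op(A) ψ⟫ = ‖A‖ (= Λ)` — the hypothesis `htop`
of the secant-bracket theorems, from eigen-data. [cite: HornJohnson2013, Thm. 4.2.2 (c)] -/
theorem inner_toEuclideanCLM_eq_l2_opNorm_of_top_eigenvector {A : Matrix S S ℝ} (hA : A.PosSemidef)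
    {ψ : EuclideanSpace ℝ S} (hψ : ‖ψ‖ = 1) {Λ : ℝ} (heig : A *ᵥ WithLp.ofLp ψ = Λ • WithLp.ofLp ψ)
    (htop : ∀ j, hA.1.eigenvalues j ≤ Λ) :
    ⟪ψ, toEuclideanCLM (n := S) (𝕜 := ℝ) A ψ⟫ = ‖A‖ ∧ ‖A‖ = Λ := by
  -- `⟪ψ, A ψ⟫ = Λ`
  have hinner : ⟪ψ, toEuclideanCLM (n := S) (𝕜 := ℝ) A ψ⟫ = Λ := by
    rw [Matrix.inner_toEuclideanCLM, heig, dotProduct_smul, smul_eq_mul]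
    have : WithLp.ofLp ψ ⬝ᵥ WithLp.ofLp ψ = ‖ψ‖ ^ 2 := by
      rw [EuclideanSpace.real_norm_sq_eq]; simp only [dotProduct, pow_two]
    rw [this, hψ, one_pow, mul_one]
  -- `Λ ≤ ‖A‖` (Cauchy–Schwarz) and `‖A‖ ≤ Λ` (all `|λ_j| = λ_j ≤ Λ`)
  have hle : Λ ≤ ‖A‖ := by
    rw [← hinner, ← Matrix.l2_opNorm_toEuclideanCLM]
    calc ⟪ψ, toEuclideanCLM (n := S) (𝕜 := ℝ) A ψ⟫ ≤ ‖ψ‖ * ‖toEuclideanCLM (n := S) (𝕜 := ℝ) A ψ‖ :=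
          real_inner_le_norm _ _
      _ ≤ ‖ψ‖ * (‖toEuclideanCLM (n := S) (𝕜 := ℝ) A‖ * ‖ψ‖) := by
          gcongr; exact ContinuousLinearMap.le_opNorm _ _
      _ = ‖toEuclideanCLM (n := S) (𝕜 := ℝ) A‖ := by rw [hψ, one_mul, mul_one]
  have hΛ0 : 0 ≤ Λ := by
    rw [← hinner, Matrix.inner_toEuclideanCLM]
    have := hA.dotProduct_mulVec_nonneg (WithLp.ofLp ψ)
    simpa using this
  have hge : ‖A‖ ≤ Λ := l2_opNorm_le_of_abs_eigenvalues_le hA.1 hΛ0 fun j => by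
    rw [abs_of_nonneg (hA.eigenvalues_nonneg j)]; exact htop j
  have hnorm : ‖A‖ = Λ := le_antisymm hge hle
  exact ⟨hinner.trans hnorm.symm, hnorm⟩

/-- `D Q D ⪰ 0` for `Q ⪰ 0` and a real diagonal `D`. [cite: HornJohnson2013, Obs. 7.1.8 (congruence
preserves positive semidefiniteness)] -/
theorem posSemidef_diagonal_mul_mul_diagonal {Q : Matrix S S ℝ} (hQ : Q.PosSemidef) (d : S → ℝ) :
    (diagonal d * Q * diagonal d).PosSemidef := by
  have h := hQ.mul_mul_conjTranspose_same (diagonal d)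
  have hDh : (diagonal d)ᴴ = diagonal d := by
    rw [Matrix.diagonal_conjTranspose]
    rfl
  rwa [hDh] at h

/-- **Secant bracket for a diagonal congruence, from eigen-data** (general chords
`x₁ < x₂ ≤ β ≤ x₃ < x₄`): as `secant_bracket_diagonal_mul_mul_diagonal'`, with the top-eigenvector
hypothesis supplied as `W_β ψ = Λ ψ`, `Λ ≥ λ_j(W_β)` for all `j` (`W_β = D_β Q D_β ⪰ 0`); then also
`‖W_β‖ = Λ`. [cite: HiriarturrutyLemarechal2001, §D.5.1 (5.1.1)–(5.1.3) (PDF p. 191)]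
[cite: HornJohnson2013, Thm. 4.2.2 (c)] [cite: Dudley2002, §6.3 Cor. 6.3.3] -/
theorem secant_bracket_diagonal_mul_mul_diagonal_of_eigenvector {Q : Matrix S S ℝ}
    (hQ : Q.PosSemidef) {d : ℝ → S → ℝ} {d' : S → ℝ} {β x₁ x₂ x₃ x₄ : ℝ} (h12 : x₁ < x₂)
    (h2 : x₂ ≤ β) (h3 : β ≤ x₃) (h34 : x₃ < x₄)
    (hconv : ∀ c, ConvexOn ℝ (Icc x₁ x₄) (fun t => d t c ^ 2))
    (hd : ∀ c, HasDerivAt (fun t => d t c) (d' c) β)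
    {ψ : EuclideanSpace ℝ S} (hψ : ‖ψ‖ = 1) {Λ : ℝ}
    (heig : (diagonal (d β) * Q * diagonal (d β)) *ᵥ WithLp.ofLp ψ = Λ • WithLp.ofLp ψ)
    (htop : ∀ j, (posSemidef_diagonal_mul_mul_diagonal hQ (d β)).1.eigenvalues j ≤ Λ) :
    ‖diagonal (d β) * Q * diagonal (d β)‖ = Λ ∧
    (‖diagonal (d x₂) * Q * diagonal (d x₂)‖ - ‖diagonal (d x₁) * Q * diagonal (d x₁)‖) / (x₂ - x₁) ≤
        ⟪ψ, toEuclideanCLM (n := S) (𝕜 := ℝ)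
          (diagonal d' * Q * diagonal (d β) + diagonal (d β) * Q * diagonal d') ψ⟫ ∧
      ⟪ψ, toEuclideanCLM (n := S) (𝕜 := ℝ)
          (diagonal d' * Q * diagonal (d β) + diagonal (d β) * Q * diagonal d') ψ⟫ ≤
        (‖diagonal (d x₄) * Q * diagonal (d x₄)‖ - ‖diagonal (d x₃) * Q * diagonal (d x₃)‖) /
          (x₄ - x₃) := by
  obtain ⟨hin, hnorm⟩ := inner_toEuclideanCLM_eq_l2_opNorm_of_top_eigenvector
    (posSemidef_diagonal_mul_mul_diagonal hQ (d β)) hψ heig htop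
  exact ⟨hnorm, secant_bracket_diagonal_mul_mul_diagonal' hQ h12 h2 h3 h34 hconv hd hψ hin⟩

end TopEigenvalue

end Literature.Analysis.OperatorTheory

end
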